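import Summits.CriticalPhenomena.PercolationContinuityZ3.Theorems.PercNearOneGluingAdditiveGluingBlockGoodThreeRelaysConvex
import HarnessLib

/-! # Crux `PercNearOneGluing.AdditiveGluing` (stmt-CriticalPhenomena-4576), stub `stub_goodStep` — the residual kernel for
# ANY number of relays under capture control of ONE relay

TTRL deep seat (variant V1357 = the hypothesis `hres` of the landed capstone `goodStep_of_residualKernel`: the block kernel
on the residue `4 ≤ A.card`, bad block, drift); lands `--supports stmt-CriticalPhenomena-4576`; no definitions, no named
facts.  This is the relay-count-free form of `blockGood_threeRelays_of_captureControl` (same seat).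

**Theorem (`blockGood_of_captureControl`).**  `μ = prodBernoulli u`; ANY relay set `A` with `b, a₀, a₁ ∈ A` and
`μ(a₀ ↔ b) ≤ μ(a₁ ↔ b)` (e.g. `a₀` the designated worst relay and `a₁` any other relay); `S` ANY block (even `∅`),
`K_S = ⋃_{s∈S} C(s)`, `fᵢ(W) = μ(K_S = W, aᵢ ↔ b)`; `sel` ANY selection of vertices.  If
`μ(a₁ ↔ b; b, a₀, a₁ ∉ K_S; K_S ∩ A ≠ ∅) + Σ_{W ∩ A = ∅} (min(f₀ W, f₁ W) − μ(K_S = W) μ(sel W ↔ b in Wᶜ))⁺ ≤ μ(b ∈ K_S; a₀, a₁ ∉ K_S)`,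
then the residual kernel holds:
`μ(a₀ ↔ b) + μ(a₀ ↮ b, a₀ ↔ S, S ↔ b) ≤ μ(S ↔ b) + Σ_{W ∩ A = ∅} μ(K_S = W) · μ(sel W ↔ b in Wᶜ)`.
No minimality of `a₀` over `A`, no badness, no drift hypothesis, no `sel W ∈ A` and no bound on `A.card` are needed: every hypothesis of
V1357 except `μ(a₀ ↔ b) ≤ μ(a₁ ↔ b)` is idle for this part, and the irreducible residue of V1357 is the complementary
regime ("the block's cluster captures some relay other than `a₀, a₁` WITHOUT the target while `a₁` reaches the target,
or the selection is locally worse than both `a₀, a₁` off a dead pocket, more often than it captures the target missing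
`a₀, a₁`") for EVERY choice of `a₁ ∈ A`.
Proof: exchange normal form at `a₀`; ONE application of Kozma–Nitzan's Lemma 3 for the observer SET `S`
(`SandwichSet.lemma3_sandwich_set`) with the family `{T ∌ a₀ | a₁ ∈ T ∨ (T ∩ A ≠ ∅ ∌ b)} ∪ {dead W : f₁ < f₀}`; pocket
identity `f₀ ≤ g + (f₀ − f₁)⁺ + (min(f₀,f₁) − g)⁺` for the selected pocket term `g`.
[cite: KozmaNitzan2024, §3.2 (Definition p. 12, Thms 4–5 pp. 12–14, Question 7 p. 36), Lemma 3 (pp. 6–7)]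
-/

namespace Summit.CriticalPhenomena.PercolationContinuityZ3.Theorems

open MeasureTheory Set
open Literature.Probability.LatticeModels (prodBernoulli)
open Literature.Probability.Percolation (BondConfig openConn openConnIn openGraph openCluster)
open scoped BigOperators

noncomputable section
open Classical

section BlockGoodCaptureControl

open Literature.Probability.LatticeModels Literature.Probability.Percolation

variable {n : ℕ}

/-- **The residual kernel for any number of relays under capture control of one relay.**  See the module docstring.
[cite: KozmaNitzan2024, §3.2 (Definition p. 12, Question 7 p. 36), Lemma 3 (pp. 6–7)] -/
theorem blockGood_of_captureControl (u : Sym2 (Fin n) → unitInterval) (A S : Finset (Fin n))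
    (b a₀ a₁ : Fin n) (sel : Finset (Fin n) → Fin n)
    (hbA : b ∈ A) (ha₀ : a₀ ∈ A) (ha₁ : a₁ ∈ A)
    (h₀₁ : (prodBernoulli u).real (openConn a₀ b) ≤ (prodBernoulli u).real (openConn a₁ b))
    (hcap : (prodBernoulli u).real (openConn a₁ b ∩ (⋃ s ∈ S, openConn s b)ᶜ ∩ (⋃ s ∈ S, openConn s a₁)ᶜ
          ∩ (⋃ s ∈ S, openConn s a₀)ᶜ ∩ {ω | ∃ a ∈ A, ω ∈ ⋃ s ∈ S, openConn s a})
        + ∑ W ∈ (Finset.univ : Finset (Finset (Fin n))).filter (fun W => Disjoint W A),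
            max (min ((prodBernoulli u).real ({ω : BondConfig (Fin n) | ∀ z : Fin n, (z ∈ W ↔ ω ∈ ⋃ s ∈ S, openConn s z)}
                        ∩ openConn a₀ b))
                      ((prodBernoulli u).real ({ω : BondConfig (Fin n) | ∀ z : Fin n, (z ∈ W ↔ ω ∈ ⋃ s ∈ S, openConn s z)}
                        ∩ openConn a₁ b))
                  - (prodBernoulli u).real {ω : BondConfig (Fin n) | ∀ z : Fin n, (z ∈ W ↔ ω ∈ ⋃ s ∈ S, openConn s z)}
                      * (prodBernoulli u).real (openConnIn ((W : Set (Fin n))ᶜ) (sel W) b)) 0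
        ≤ (prodBernoulli u).real ((⋃ s ∈ S, openConn s b) ∩ (⋃ s ∈ S, openConn s a₀)ᶜ
            ∩ (⋃ s ∈ S, openConn s a₁)ᶜ)) :
    (prodBernoulli u).real (openConn a₀ b)
        + (prodBernoulli u).real
            ((openConn a₀ b)ᶜ ∩ (⋃ s ∈ S, openConn a₀ s) ∩ (⋃ s ∈ S, openConn s b))
      ≤ (prodBernoulli u).real (⋃ s ∈ S, openConn s b)
        + ∑ W ∈ (Finset.univ : Finset (Finset (Fin n))).filter (fun W => Disjoint W A),
            (prodBernoulli u).real {ω : BondConfig (Fin n) | ∀ z : Fin n, (z ∈ W ↔ ω ∈ ⋃ s ∈ S, openConn s z)}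
              * (prodBernoulli u).real (openConnIn ((W : Set (Fin n))ᶜ) (sel W) b) := by
  set μ := prodBernoulli u with hμ
  have hms : ∀ s : Set (BondConfig (Fin n)), MeasurableSet s := fun _ => MeasurableSet.of_discrete
  -- notation
  set KW : Finset (Fin n) → Set (BondConfig (Fin n)) :=
    fun W => {ω : BondConfig (Fin n) | ∀ z : Fin n, (z ∈ W ↔ ω ∈ ⋃ s ∈ S, openConn s z)} with hKW
  set Y : Set (BondConfig (Fin n)) := ⋃ s ∈ S, openConn s b with hY
  set Xs : Set (BondConfig (Fin n)) := ⋃ s ∈ S, openConn a₀ s with hXs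
  set X₀ : Set (BondConfig (Fin n)) := ⋃ s ∈ S, openConn s a₀ with hX₀
  set X₁ : Set (BondConfig (Fin n)) := ⋃ s ∈ S, openConn s a₁ with hX₁
  set Z : Set (BondConfig (Fin n)) := {ω | ∃ a ∈ A, ω ∈ ⋃ s ∈ S, openConn s a} with hZ
  set 𝒟 : Finset (Finset (Fin n)) := (Finset.univ : Finset (Finset (Fin n))).filter (fun W => Disjoint W A) with h𝒟
  set f₀ : Finset (Fin n) → ℝ := fun W => μ.real (KW W ∩ openConn a₀ b) with hf₀
  set f₁ : Finset (Fin n) → ℝ := fun W => μ.real (KW W ∩ openConn a₁ b) with hf₁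
  set g : Finset (Fin n) → ℝ := fun W => μ.real (KW W) * μ.real (openConnIn ((W : Set (Fin n))ᶜ) (sel W) b) with hg
  have hXs' : Xs = X₀ := by
    simp only [hXs, hX₀, knThm2_openConn_comm a₀]
  have hmemY : ∀ ω, ω ∈ Y ↔ ∃ s ∈ S, (openGraph ω).Reachable s b := fun ω => by
    simp only [hY, Set.mem_iUnion, exists_prop]; exact Iff.rfl
  have hmemX₀ : ∀ ω, ω ∈ X₀ ↔ ∃ s ∈ S, (openGraph ω).Reachable s a₀ := fun ω => by
    simp only [hX₀, Set.mem_iUnion, exists_prop]; exact Iff.rfl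
  have hmemX₁ : ∀ ω, ω ∈ X₁ ↔ ∃ s ∈ S, (openGraph ω).Reachable s a₁ := fun ω => by
    simp only [hX₁, Set.mem_iUnion, exists_prop]; exact Iff.rfl
  have hmemXa : ∀ (ω : BondConfig (Fin n)) (a : Fin n),
      (ω ∈ ⋃ s ∈ S, openConn s a) ↔ ∃ s ∈ S, (openGraph ω).Reachable s a := fun ω a => by
    simp only [Set.mem_iUnion, exists_prop]; exact Iff.rfl
  have hmemZ : ∀ ω, ω ∈ Z ↔ ∃ a ∈ A, ∃ s ∈ S, (openGraph ω).Reachable s a := fun ω => by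
    simp only [hZ, Set.mem_setOf_eq, hmemXa]
  have hK : ∀ (ω : BondConfig (Fin n)) (a : Fin n),
      (a ∈ ⋃ o ∈ S, openCluster ω o) ↔ ∃ o ∈ S, (openGraph ω).Reachable o a :=
    fun ω a => SandwichSet.mem_kUnion_iff ω S a
  have hmem𝒟 : ∀ W, W ∈ 𝒟 ↔ Disjoint W A := fun W => by simp [h𝒟]
  -- (S1) the dead part of `τ(a₀)` is the fibre sum of `f₀`
  have hP3 : μ.real (openConn a₀ b ∩ Yᶜ ∩ Zᶜ) = ∑ W ∈ 𝒟, f₀ W := by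
    have h := blockPocket_sum_dead u S A (openConn a₀ b)
    simp only [hf₀, h𝒟, hKW]
    rw [h]
    congr 1; ext ω
    simp only [Set.mem_inter_iff, Set.mem_compl_iff, Set.mem_setOf_eq, hmemY, hmemZ, hmemXa,
      not_exists, not_and]
    constructor
    · rintro ⟨⟨hab, -⟩, hZc⟩
      exact ⟨hab, fun a ha s hs hsa => hZc a ha s hs hsa⟩
    · rintro ⟨hab, hdead⟩
      exact ⟨⟨hab, fun s hs hsb => hdead b hbA s hs hsb⟩, fun a ha s hs hsa => hdead a ha s hs hsa⟩
  -- (S2) `τ(a₀) = P1 + A1 + P3`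
  have hτ : μ.real (openConn a₀ b) = μ.real (openConn a₀ b ∩ Y) + μ.real (openConn a₀ b ∩ Yᶜ ∩ Z)
      + μ.real (openConn a₀ b ∩ Yᶜ ∩ Zᶜ) := by
    have e1 := measureReal_inter_add_sdiff (μ := μ) (s := openConn a₀ b) (hms Y) (measure_ne_top _ _)
    have e2 := measureReal_inter_add_sdiff (μ := μ) (s := openConn a₀ b ∩ Yᶜ) (hms Z) (measure_ne_top _ _)
    rw [Set.sdiff_eq] at e1 e2
    linarith
  -- (S3) `μ(Y) = Q1 + Q2 + Q3`
  have hYd : μ.real Y = μ.real (openConn a₀ b ∩ Y)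
      + μ.real ((openConn a₀ b)ᶜ ∩ Xs ∩ Y) + μ.real (Y ∩ (openConn a₀ b)ᶜ ∩ Xsᶜ) := by
    have e1 := measureReal_inter_add_sdiff (μ := μ) (s := Y) (hms (openConn a₀ b)) (measure_ne_top _ _)
    have e2 := measureReal_inter_add_sdiff (μ := μ) (s := Y ∩ (openConn a₀ b)ᶜ) (hms Xs) (measure_ne_top _ _)
    rw [Set.sdiff_eq] at e1 e2
    rw [Set.inter_comm Y (openConn a₀ b)] at e1
    have e3 : Y ∩ (openConn a₀ b)ᶜ ∩ Xs = (openConn a₀ b)ᶜ ∩ Xs ∩ Y := by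
      ext ω; simp only [Set.mem_inter_iff]; tauto
    rw [e3] at e2
    linarith
  -- (S4) `Q3 ≥ μ(b ∈ K_S, a₀ ∉ K_S)`
  have hQ3 : μ.real (Y ∩ X₀ᶜ) ≤ μ.real (Y ∩ (openConn a₀ b)ᶜ ∩ Xsᶜ) := by
    rw [hXs']
    refine measureReal_mono (fun ω hω => ?_) (measure_ne_top _ _)
    simp only [Set.mem_inter_iff, Set.mem_compl_iff, hmemY, hmemX₀, not_exists, not_and] at hω ⊢
    obtain ⟨⟨s, hs, hsb⟩, hX0c⟩ := hω
    exact ⟨⟨⟨s, hs, hsb⟩, fun hab => hX0c s hs (hsb.trans (show (openGraph ω).Reachable a₀ b from hab).symm)⟩, hX0c⟩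
  -- (S5) Lemma 3 for the observer set `S`, exchange `a₀ → a₁`
  set R₁ : Finset (Finset (Fin n)) := 𝒟.filter (fun W => f₁ W < f₀ W) with hR₁
  have hR₁A : ∀ W ∈ R₁, Disjoint W A := fun W hW => (hmem𝒟 W).1 (Finset.mem_filter.1 hW).1
  set Q₁ : Set (Fin n) → Prop := fun T => a₀ ∉ T ∧ (a₁ ∈ T ∨ (b ∉ T ∧ ∃ a ∈ A, a ∈ T)) with hQ₁
  have hR₁Q : ∀ W : Finset (Fin n), W ∈ R₁ → ¬ Q₁ (W : Set (Fin n)) := by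
    rintro W hW ⟨-, h1 | ⟨-, a, ha, haW⟩⟩
    · exact Finset.disjoint_left.1 (hR₁A W hW) (Finset.mem_coe.1 h1) ha₁
    · exact Finset.disjoint_left.1 (hR₁A W hW) (Finset.mem_coe.1 haW) ha
  set 𝓕₁ : Set (Set (Fin n)) := {T : Set (Fin n) | Q₁ T} ∪ {T | ∃ W ∈ R₁, T = (W : Set (Fin n))} with h𝓕₁
  have hlo₁ : ∀ ω : BondConfig (Fin n), a₁ ∈ (⋃ s ∈ S, openCluster ω s) → a₀ ∉ (⋃ s ∈ S, openCluster ω s) →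
      (⋃ s ∈ S, openCluster ω s) ∈ 𝓕₁ := fun ω h1 h0 => Or.inl ⟨h0, Or.inl h1⟩
  have hhi₁ : ∀ ω : BondConfig (Fin n), (⋃ s ∈ S, openCluster ω s) ∈ 𝓕₁ → a₀ ∉ (⋃ s ∈ S, openCluster ω s) := by
    rintro ω (⟨h0, -⟩ | ⟨W, hW, hWe⟩)
    · exact h0
    · rw [hWe]
      exact fun h => Finset.disjoint_left.1 (hR₁A W hW) (Finset.mem_coe.1 h) ha₀
  have hsand₁ := SandwichSet.lemma3_sandwich_set u a₀ a₁ b S 𝓕₁ hlo₁ hhi₁ h₀₁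
  have hpart₁₀ := real_inter_blockFamilyPred u S Q₁ R₁ hR₁Q (openConn a₀ b)
  have hpart₁₁ := real_inter_blockFamilyPred u S Q₁ R₁ hR₁Q (openConn a₁ b)
  rw [hpart₁₀, hpart₁₁] at hsand₁
  -- `hsand₁ : μ(a₀b ∩ {Q₁ K}) + Σ_{R₁} f₀ ≤ μ(a₁b ∩ {Q₁ K}) + Σ_{R₁} f₁`
  -- lower bound of the left bottom: `A1 ≤ μ(a₀b ∩ {Q₁ K})`
  have hA1 : μ.real (openConn a₀ b ∩ Yᶜ ∩ Z) ≤
      μ.real (openConn a₀ b ∩ {ω | Q₁ (⋃ s ∈ S, openCluster ω s)}) := by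
    refine measureReal_mono (fun ω hω => ?_) (measure_ne_top _ _)
    simp only [Set.mem_inter_iff, Set.mem_compl_iff, hmemY, hmemZ, not_exists, not_and] at hω
    obtain ⟨⟨hab, hYc⟩, a, ha, s, hs, hsa⟩ := hω
    refine ⟨hab, ?_, Or.inr ⟨fun hb => ?_, a, ha, (hK ω a).2 ⟨s, hs, hsa⟩⟩⟩
    · intro h0
      obtain ⟨s', hs', hs'0⟩ := (hK ω a₀).1 h0
      exact hYc s' hs' (hs'0.trans hab)
    · obtain ⟨s', hs', hs'b⟩ := (hK ω b).1 hb
      exact hYc s' hs' hs'b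
  -- upper bound of the right bottom: `μ(a₁b ∩ {Q₁ K}) ≤ μ(Y ∩ X₁ ∩ X₀ᶜ) + μ(L)`
  set L : Set (BondConfig (Fin n)) := openConn a₁ b ∩ Yᶜ ∩ X₁ᶜ ∩ X₀ᶜ ∩ Z with hL
  have hU₁ : μ.real (openConn a₁ b ∩ {ω | Q₁ (⋃ s ∈ S, openCluster ω s)}) ≤
      μ.real (Y ∩ X₁ ∩ X₀ᶜ) + μ.real L := by
    refine (measureReal_mono (fun ω hω => ?_) (measure_ne_top _ _)).trans (measureReal_union_le _ _)
    simp only [Set.mem_inter_iff, Set.mem_setOf_eq] at hω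
    obtain ⟨h1b, h0, hor⟩ := hω
    have h0' : ω ∉ X₀ := fun h => by
      obtain ⟨s, hs, hs0⟩ := (hmemX₀ ω).1 h
      exact h0 ((hK ω a₀).2 ⟨s, hs, hs0⟩)
    by_cases h1 : a₁ ∈ ⋃ s ∈ S, openCluster ω s
    · obtain ⟨s, hs, hs1⟩ := (hK ω a₁).1 h1
      refine Or.inl ⟨⟨(hmemY ω).2 ⟨s, hs, hs1.trans h1b⟩, (hmemX₁ ω).2 ⟨s, hs, hs1⟩⟩, h0'⟩
    · rcases hor with h1' | ⟨hb, a, ha, haK⟩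
      · exact absurd h1' h1
      · refine Or.inr ⟨⟨⟨⟨h1b, fun hYω => ?_⟩, fun hX1 => ?_⟩, h0'⟩, ?_⟩
        · obtain ⟨s, hs, hsb⟩ := (hmemY ω).1 hYω
          exact hb ((hK ω b).2 ⟨s, hs, hsb⟩)
        · obtain ⟨s, hs, hs1⟩ := (hmemX₁ ω).1 hX1
          exact h1 ((hK ω a₁).2 ⟨s, hs, hs1⟩)
        · obtain ⟨s, hs, hsa⟩ := (hK ω a).1 haK
          exact (hmemZ ω).2 ⟨a, ha, s, hs, hsa⟩
  -- (S6) pocket arithmetic: `Σ_𝒟 f₀ ≤ Σ_𝒟 g + Σ_{R₁} (f₀ − f₁) + Σ_𝒟 (min(f₀,f₁) − g)⁺`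
  have hS7 : ∑ W ∈ 𝒟, f₀ W ≤ ∑ W ∈ 𝒟, g W
      + (∑ W ∈ R₁, f₀ W - ∑ W ∈ R₁, f₁ W) + ∑ W ∈ 𝒟, max (min (f₀ W) (f₁ W) - g W) 0 := by
    have hpt : ∀ W, f₀ W ≤ g W
        + (if f₁ W < f₀ W then f₀ W - f₁ W else 0) + max (min (f₀ W) (f₁ W) - g W) 0 := by
      intro W
      have h01 : f₀ W ≤ min (f₀ W) (f₁ W) + (if f₁ W < f₀ W then f₀ W - f₁ W else 0) := by
        by_cases h1 : f₁ W < f₀ W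
        · rw [if_pos h1, min_eq_right h1.le]; linarith
        · rw [if_neg h1, min_eq_left (not_lt.1 h1)]; linarith
      have hmax : min (f₀ W) (f₁ W) - g W ≤ max (min (f₀ W) (f₁ W) - g W) 0 := le_max_left _ _
      linarith
    have hR₁sum : ∑ W ∈ R₁, f₀ W - ∑ W ∈ R₁, f₁ W = ∑ W ∈ 𝒟, (if f₁ W < f₀ W then f₀ W - f₁ W else 0) := by
      rw [← Finset.sum_sub_distrib, hR₁, Finset.sum_filter]
    rw [hR₁sum, ← Finset.sum_add_distrib, ← Finset.sum_add_distrib]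
    exact Finset.sum_le_sum fun W _ => hpt W
  -- (S7) the bookkeeping of the `Y`-events
  have d1 : μ.real (Y ∩ X₀ᶜ) = μ.real (Y ∩ X₁ ∩ X₀ᶜ) + μ.real (Y ∩ X₀ᶜ ∩ X₁ᶜ) := by
    have e := measureReal_inter_add_sdiff (μ := μ) (s := Y ∩ X₀ᶜ) (hms X₁) (measure_ne_top _ _)
    rw [Set.sdiff_eq] at e
    have e' : Y ∩ X₀ᶜ ∩ X₁ = Y ∩ X₁ ∩ X₀ᶜ := by
      ext ω; simp only [Set.mem_inter_iff]; tauto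
    rw [e'] at e
    linarith
  -- the capture hypothesis in the local notation
  have hcap' : μ.real L + ∑ W ∈ 𝒟, max (min (f₀ W) (f₁ W) - g W) 0 ≤ μ.real (Y ∩ X₀ᶜ ∩ X₁ᶜ) := hcap
  -- combine
  have hsumR₁₀ : ∑ W ∈ R₁, μ.real ({ω : BondConfig (Fin n) | ∀ z : Fin n, (z ∈ W ↔ ω ∈ ⋃ s ∈ S, openConn s z)} ∩
      openConn a₀ b) = ∑ W ∈ R₁, f₀ W := rfl
  have hsumR₁₁ : ∑ W ∈ R₁, μ.real ({ω : BondConfig (Fin n) | ∀ z : Fin n, (z ∈ W ↔ ω ∈ ⋃ s ∈ S, openConn s z)} ∩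
      openConn a₁ b) = ∑ W ∈ R₁, f₁ W := rfl
  rw [hsumR₁₀, hsumR₁₁] at hsand₁
  have hgoal : ∑ W ∈ (Finset.univ : Finset (Finset (Fin n))).filter (fun W => Disjoint W A),
      μ.real {ω : BondConfig (Fin n) | ∀ z : Fin n, (z ∈ W ↔ ω ∈ ⋃ s ∈ S, openConn s z)}
        * μ.real (openConnIn ((W : Set (Fin n))ᶜ) (sel W) b) = ∑ W ∈ 𝒟, g W := rfl
  rw [hgoal]
  linarith [hP3, hτ, hYd, hQ3, hA1, hU₁, hsand₁, hS7, d1, hcap']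

end BlockGoodCaptureControl

open Literature.Probability.LatticeModels Literature.Probability.Percolation in
/-- **V1357 (the residual kernel `hres` of `goodStep_of_residualKernel`) under capture control of one relay**: the exact
binder shape of TTRL variant V1357 of `stmt-CriticalPhenomena-4576` (bad block `2 ≤ S.card` disjoint from `A`,
`4 ≤ A.card`, drift), with the capture-control hypothesis for SOME relay `a₁ ∈ A` added; the badness, drift and
cardinality hypotheses are idle (`blockGood_of_captureControl`).  The complementary regime is the open residue of V1357.
[cite: KozmaNitzan2024, §3.2 (Definition p. 12, Question 7 p. 36), Lemma 3 (pp. 6–7)] -/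
theorem residualKernel_v1357_of_captureControl : ∀ (n : ℕ) (u : Sym2 (Fin n) → unitInterval) (A S : Finset (Fin n)) (b a₀ : Fin n) (sel : Finset (Fin n) → Fin n), b ∈ A → Disjoint S A → 2 ≤ S.card → 4 ≤ A.card → (∀ W, sel W ∈ A) → a₀ ∈ A → (∀ a ∈ A, (prodBernoulli u).real (openConn a₀ b) ≤ (prodBernoulli u).real (openConn a b)) → (∀ v ∈ S, (prodBernoulli u).real (openConn v b) < (prodBernoulli u).real (openConn a₀ b)) → (∃ a ∈ A, (prodBernoulli (fun e : Sym2 (Fin n) => if (∀ x ∈ e, x ∈ S) ∧ ¬ e.IsDiag then 1 else u e)).real (openConn a b) < (prodBernoulli (fun e : Sym2 (Fin n) => if (∀ x ∈ e, x ∈ S) ∧ ¬ e.IsDiag then 1 else u e)).real (openConn a₀ b)) → ∀ a₁ ∈ A, (prodBernoulli u).real (openConn a₁ b ∩ (⋃ s ∈ S, openConn s b)ᶜ ∩ (⋃ s ∈ S, openConn s a₁)ᶜ ∩ (⋃ s ∈ S, openConn s a₀)ᶜ ∩ {ω | ∃ a ∈ A, ω ∈ ⋃ s ∈ S, openConn s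 a}) + ∑ W ∈ (Finset.univ : Finset (Finset (Fin n))).filter (fun W => Disjoint W A), max (min ((prodBernoulli u).real ({ω : BondConfig (Fin n) | ∀ z : Fin n, (z ∈ W ↔ ω ∈ ⋃ s ∈ S, openConn s z)} ∩ openConn a₀ b)) ((prodBernoulli u).real ({ω : BondConfig (Fin n) | ∀ z : Fin n, (z ∈ W ↔ ω ∈ ⋃ s ∈ S, openConn s z)} ∩ openConn a₁ b)) - (prodBernoulli u).real {ω : BondConfig (Fin n) | ∀ z : Fin n, (z ∈ W ↔ ω ∈ ⋃ s ∈ S, openConn s z)} * (prodBernoulli u).real (openConnIn ((W : Set (Fin n))ᶜ) (sel W) b)) 0 ≤ (prodBernoulli u).real ((⋃ s ∈ S, openConn s b) ∩ (⋃ s ∈ S, openConn s a₀)ᶜ ∩ (⋃ s ∈ S, openConn s a₁)ᶜ) → (prodBernoulli u).real (openConn a₀ b) + (prodBernoulli u).real ((openConn a₀ b)ᶜ ∩ (⋃ s ∈ S, openConn a₀ s) ∩ (⋃ s ∈ S, openConn s b)) ≤ (prodBernoulli u).real (⋃ s ∈ S, openConn s b) + ∑ W ∈ (Finset.univ : Finset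 (Finset (Fin n))).filter (fun W => Disjoint W A), (prodBernoulli u).real {ω : BondConfig (Fin n) | ∀ z : Fin n, (z ∈ W ↔ ω ∈ ⋃ s ∈ S, openConn s z)} * (prodBernoulli u).real (openConnIn ((W : Set (Fin n))ᶜ) (sel W) b) :=
  fun _ u A S b a₀ sel hbA _ _ _ _ ha₀ hmin _ _ a₁ ha₁ hcap =>
    blockGood_of_captureControl u A S b a₀ a₁ sel hbA ha₀ ha₁ (hmin a₁ ha₁) hcap

open Literature.Probability.LatticeModels Literature.Probability.Percolation in
/-- Registered helper stub `stub_blockGoodCaptureControl_v1357` (ttrl deep seat V1357): **the residual kernel for any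
number of relays under capture control of one relay** (= `blockGood_of_captureControl`, ∀-form).
[cite: KozmaNitzan2024, §3.2 (Definition p. 12, Question 7 p. 36), Lemma 3 (pp. 6–7)] -/
theorem stub_blockGoodCaptureControl_v1357 : ∀ (n : ℕ) (u : Sym2 (Fin n) → unitInterval) (A S : Finset (Fin n)) (b a₀ a₁ : Fin n) (sel : Finset (Fin n) → Fin n), b ∈ A → a₀ ∈ A → a₁ ∈ A → (prodBernoulli u).real (openConn a₀ b) ≤ (prodBernoulli u).real (openConn a₁ b) → (prodBernoulli u).real (openConn a₁ b ∩ (⋃ s ∈ S, openConn s b)ᶜ ∩ (⋃ s ∈ S, openConn s a₁)ᶜ ∩ (⋃ s ∈ S, openConn s a₀)ᶜ ∩ {ω | ∃ a ∈ A, ω ∈ ⋃ s ∈ S, openConn s a}) + ∑ W ∈ (Finset.univ : Finset (Finset (Fin n))).filter (fun W => Disjoint W A), max (min ((prodBernoulli u).real ({ω : BondConfig (Fin n) | ∀ z : Fin n, (z ∈ W ↔ ω ∈ ⋃ s ∈ S, openConn s z)} ∩ openConn a₀ b)) ((prodBernoulli u).real ({ω : BondConfig (Fin n) | ∀ z : Fin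 n, (z ∈ W ↔ ω ∈ ⋃ s ∈ S, openConn s z)} ∩ openConn a₁ b)) - (prodBernoulli u).real {ω : BondConfig (Fin n) | ∀ z : Fin n, (z ∈ W ↔ ω ∈ ⋃ s ∈ S, openConn s z)} * (prodBernoulli u).real (openConnIn ((W : Set (Fin n))ᶜ) (sel W) b)) 0 ≤ (prodBernoulli u).real ((⋃ s ∈ S, openConn s b) ∩ (⋃ s ∈ S, openConn s a₀)ᶜ ∩ (⋃ s ∈ S, openConn s a₁)ᶜ) → (prodBernoulli u).real (openConn a₀ b) + (prodBernoulli u).real ((openConn a₀ b)ᶜ ∩ (⋃ s ∈ S, openConn a₀ s) ∩ (⋃ s ∈ S, openConn s b)) ≤ (prodBernoulli u).real (⋃ s ∈ S, openConn s b) + ∑ W ∈ (Finset.univ : Finset (Finset (Fin n))).filter (fun W => Disjoint W A), (prodBernoulli u).real {ω : BondConfig (Fin n) | ∀ z : Fin n, (z ∈ W ↔ ω ∈ ⋃ s ∈ S, openConn s z)} * (prodBernoulli u).real (openConnIn ((W : Set (Fin n))ᶜ) (sel W) b) :=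
  fun _ u A S b a₀ a₁ sel hbA ha₀ ha₁ h₀₁ hcap =>
    blockGood_of_captureControl u A S b a₀ a₁ sel hbA ha₀ ha₁ h₀₁ hcap

end

end Summit.CriticalPhenomena.PercolationContinuityZ3.Theorems
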